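import Literature.AlgebraicGeometry.Frobenioids.ArchimedeanFrobenioidRelative
import Literature.AlgebraicGeometry.Frobenioids.ArchimedeanRCConnected
import Literature.AlgebraicGeometry.Frobenioids.PadicFrobenioidQp
import HarnessLib

/-!
# Frobenioids II, Example 3.3 over the one-morphism base: the archimedean Frobenioid `C` at a
# complex place and its monoid `O^▷ ≅ O^▷_ℂ` (the [FrdII]-side ingredients of [IUTchI] Example 3.4 (i))

Mochizuki, *The geometry of Frobenioids II: poly-Frobenioids*, Kyushu J. Math. **62** (2008)
401–460, §3, Example 3.3 (i)–(ii), author's kurims text p. 28 ll. 20–29: "if `D` is any connected,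
totally epimorphic category, and `D → D₀` is a functor, then by setting `C := C₀ ×_{D₀} D`,
`Φ := Φ₀|_D` we obtain a pre-Frobenioid structure `C → F_Φ` on `C`" and (ii) "`C` is a Frobenioid"
[cite: MochizukiFrdII2008, Ex 3.3 (ii) p.28]; the base used at an archimedean place of a number field
is the ONE-MORPHISM category: Mochizuki, *Inter-universal Teichmüller theory I*, Example 3.4 (i),
kurims text (May 2020) p. 80: "write … `C_v` for the archimedean Frobenioid as in [FrdII], Example 3.3,
(ii) [i.e., "`C`" of loc. cit.], where we take the base category [i.e., "`D`" of loc. cit.] to be the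
one-morphism category determined by `Spec(K_v)` … it makes sense to write "`O^▷(C_v)`" … by
construction, there is a natural isomorphism `O^▷(C_v) ⥲ O^▷_{K_v}` of topological monoids"
[cite: Mochizuki2012, Ex 3.4 (i) p.80] (claim key of the series; the content used here is the
classical [FrdII] construction only — nothing disputed is involved and no side is taken on
[IUTchIII] Cor. 3.12).

CONTENTS (everything PROVED; seat abc-iut-L1-t6, one writer of the Ex. 3.3 objects):
* `ArchFrd.ptBase : Discrete PUnit ⥤ D0` — the one-morphism base at `Spec ℂ`; its standing hypotheses
  `pt_isGraphConnected` and (abc-iut-L1-t4's, reused) `PadicFrd.isTotallyEpimorphic_discretePUnit`;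
* `ArchFrd.Cpt := C ptBase` — THE category "`C`" of Ex. 3.3 over it, a Frobenioid
  (`Cpt.isFrobenioid`, by abc-iut-L1-d7's `Ex33ii_isFrobenioid_holds`); every object lies over
  `Spec ℂ` (`Cpt.base_eq_complex`);
* `Cpt.std t` — the isotropic object of tip `t`; it is PSEUDO-TERMINAL ([FrdI] §0; `Cpt.std_isPseudoTerminal`);
* `ArchFrd.unitDisc = O^▷_ℂ := {z ∈ ℂ | z ≠ 0, ‖z‖ ≤ 1}` (spelled as in the L5 file
  `LocalFrobenioidsArch.lean`, `unitDiscMonoid ℂ`, so the two agree definitionally);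
* `Cpt.endEquivUnitDisc t : O^▷(std t) ≃* O^▷_ℂ`, where `O^▷(−)` is found's
  `PreFrobenioid.endSubmonoid` (base-identity LINEAR endomorphisms, [FrdI] Def. 1.2 (ii)) — the
  "natural isomorphism `O^▷(C_v) ⥲ O^▷_{K_v}`" at the level of monoids, the same for every tip `t`;
* for consumers that want `O^▷(C_v)` as a topological monoid: `Cpt.endCommMonoid`, `Cpt.endTopology`
  (the topology INDUCED from `ℂ` along the scalar map — a definition, NOT the category-theoretic
  reconstruction of the topology of [FrdII] Thm. 3.6 (i), (vii), which is abc-iut-L1-t9's typed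
  statement), `Cpt.endContinuousMul`, `Cpt.continuous_endEquivUnitDisc(_symm)`.
No `instance`, no notation. Imports only built [FrdII] files (§3, and `PadicFrobenioidQp` for the
one-object-base lemma); nothing under `Literature/IUT` is imported (the [IUTchI]-side adapter lives with
the L5 interface).
-/

namespace Literature.AlgebraicGeometry.Frobenioids

open CategoryTheory Topology
open scoped Pointwise

noncomputable section

namespace ArchFrd

/-! ### `O^▷_ℂ` -/

/-- `O^▷_ℂ ⊆ ℂ`: the multiplicative monoid of nonzero complex numbers of absolute value `≤ 1`
([IUTchI] §0 "`O^▷`"; Ex. 3.4 (i) "`O^▷_{K_v}`"), spelled exactly as `unitDiscMonoid ℂ` of the L5 file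
`LocalFrobenioidsArch.lean`. [cite: Mochizuki2012, Ex 3.4 (i) p.80] -/
def unitDisc : Submonoid ℂ where
  carrier := {z | z ≠ 0 ∧ ‖z‖ ≤ 1}
  mul_mem' := by
    rintro a b ⟨ha, ha'⟩ ⟨hb, hb'⟩
    refine ⟨mul_ne_zero ha hb, ?_⟩
    rw [norm_mul]
    exact mul_le_one₀ ha' (norm_nonneg _) hb'
  one_mem' := ⟨one_ne_zero, by rw [norm_one]⟩

/-- Membership in `O^▷_ℂ`. [cite: Mochizuki2012, Ex 3.4 (i) p.80] -/
@[simp] theorem mem_unitDisc {z : ℂ} : z ∈ unitDisc ↔ z ≠ 0 ∧ ‖z‖ ≤ 1 := Iff.rfl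

/-! ### The one-morphism base at `Spec ℂ` -/

/-- The one-morphism category mapped to `Spec ℂ ∈ Ob(D₀)`: "we take the base category … to be the
one-morphism category determined by `Spec(K_v)`" (`K_v` a complex archimedean field).
[cite: Mochizuki2012, Ex 3.4 (i) p.80] -/
def ptBase : Discrete PUnit.{1} ⥤ D0 := (Functor.const _).obj D0.complex

/-- `ptBase` sends the object to `Spec ℂ`. [cite: Mochizuki2012, Ex 3.4 (i) p.80] -/
@[simp] theorem ptBase_obj (d : Discrete PUnit.{1}) : ptBase.obj d = D0.complex := rfl

/-- `ptBase` sends the (identity) arrow to the identity. [cite: Mochizuki2012, Ex 3.4 (i) p.80] -/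
@[simp] theorem ptBase_map {d d' : Discrete PUnit.{1}} (f : d ⟶ d') : ptBase.map f = 𝟙 D0.complex := rfl

/-- The one-morphism category is connected (standing hypothesis of Ex. 3.3, p. 28 ll. 20–21).
[cite: MochizukiFrdII2008, Ex 3.3 (i) p.28] -/
theorem pt_isGraphConnected : IsGraphConnected (Discrete PUnit.{1}) :=
  ⟨⟨⟨PUnit.unit⟩⟩, fun X Y => by
    obtain rfl : X = Y := Subsingleton.elim _ _
    exact Relation.ReflTransGen.refl⟩

-- The one-morphism category is totally epimorphic (the other standing hypothesis of Ex. 3.3): this is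
-- abc-iut-L1-t4's `PadicFrd.isTotallyEpimorphic_discretePUnit` (`PadicFrobenioidQp.lean`, the same
-- one-object base at a nonarchimedean place), reused by name below.

/-! ### `C` over the one-morphism base -/

/-- **`C_v`**: the category "`C = C₀ ×_{D₀} D`" of [FrdII] Ex. 3.3 with `D` the one-morphism category
over `Spec ℂ` ([IUTchI] Ex. 3.4 (i)). [cite: Mochizuki2012, Ex 3.4 (i) p.80] -/
abbrev Cpt : Type := C ptBase

namespace Cpt

/-- `C_v` is a Frobenioid ([FrdII] Ex. 3.3 (ii), for the one-morphism base) — by name from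
abc-iut-L1-d7's `Ex33ii_isFrobenioid_holds`. [cite: MochizukiFrdII2008, Ex 3.3 (ii) p.28] -/
theorem isFrobenioid : PreFrobenioid.IsFrobenioid (C.toElem ptBase) :=
  Ex33ii_isFrobenioid_holds ptBase pt_isGraphConnected PadicFrd.isTotallyEpimorphic_discretePUnit

/-- Every object of `C_v` lies over `Spec ℂ`. [cite: Mochizuki2012, Ex 3.4 (i) p.80] -/
theorem base_eq_complex (Y : Cpt) : Y.fst.base = D0.complex :=
  D0.eq_complex_of_hom_complex Y.iso.hom

/-- Every object of `C_v` is complex. [cite: Mochizuki2012, Ex 3.4 (i) p.80] -/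
theorem isComplexObj (Y : Cpt) : Y.fst.IsComplexObj := base_eq_complex Y

/-- The isotropic object of `C_v` with tip `t`: `(Spec ℂ, ℂ, {0 < |z| ≤ t})`.
[cite: MochizukiFrdII2008, Ex 3.3 (i) p.27] -/
def std (t : PosReal) : Cpt := ⟨C0.isoObj .complex t, ⟨PUnit.unit⟩, Iso.refl _⟩

/-- `std t` is (naively, equivalently [Ex. 3.3 (ii)]) isotropic. [cite: MochizukiFrdII2008, Ex 3.3 (ii) p.28] -/
theorem std_isNaivelyIsotropic (t : PosReal) : (std t).fst.IsNaivelyIsotropic :=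
  AngularRegion.isIsotropic_isotropicOfTip t

/-- The arrow `(Base := the structure isomorphism of Y, 1, t/tip(Y)) : Y → std t`.
[cite: MochizukiFrdII2008, Ex 3.3 (i) p.27] -/
def toStd (t : PosReal) (Y : Cpt) : Y ⟶ std t where
  fst := C0.homToIso Y.iso.hom t (ofPosReal ℂ (t * Y.fst.region.tip⁻¹)) (ofPosReal_mem_scalars _ _)
    (by
      rw [coe_ofPosReal, RCLike.norm_ofReal, Positive.val_mul, Positive.coe_inv,
        abs_of_pos (mul_pos t.2 (inv_pos.2 Y.fst.region.tip.2))]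
      change (t : ℝ) * (Y.fst.region.tip : ℝ)⁻¹ * (Y.fst.region.tip : ℝ) ≤ t
      rw [inv_mul_cancel_right₀ Y.fst.region.tip.2.ne'])
  snd := 𝟙 _
  w := by
    change Y.iso.hom ≫ 𝟙 D0.complex = Y.iso.hom ≫ 𝟙 D0.complex
    rfl

/-- **The isotropic objects are pseudo-terminal** ("the pseudo-terminal objects of `C`", [IUTchI]
Ex. 3.4 (i); [FrdI] §0): every object maps to `std t`. [cite: Mochizuki2012, Ex 3.4 (i) p.80] -/
theorem std_isPseudoTerminal (t : PosReal) : IsPseudoTerminal (std t) := fun Y => ⟨toStd t Y⟩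

/-! ### `O^▷(std t) ≅ O^▷_ℂ` -/

variable {t : PosReal}

/-- The `C₀`-component of an endomorphism of `std t` lies over the identity of `Spec ℂ`.
[cite: MochizukiFrdII2008, Ex 3.3 (i) p.27] -/
theorem base_fst_eq_id (φ : std t ⟶ std t) : C0.Base φ.fst = 𝟙 D0.complex := by
  have w := φ.w
  change C0.Base φ.fst ≫ 𝟙 D0.complex = 𝟙 D0.complex ≫ 𝟙 D0.complex at w
  rw [Category.id_comp] at w
  erw [Category.comp_id] at w
  exact w

/-- A linear endomorphism `φ` of `std t` (i.e. an element of `O^▷(std t)`) has `deg_Fr = 1` on its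
`C₀`-component. [cite: MochizukiFrdI2008, Def. 1.2(ii)] -/
theorem degFr_fst_eq_one {φ : std t ⟶ std t}
    (hφ : φ ∈ PreFrobenioid.endSubmonoid (C.toElem ptBase) (std t)) : C0.degFr φ.fst = 1 :=
  hφ.2

/-- The scalar of an element of `O^▷(std t)` lies in `O^▷_ℂ`: it is nonzero and, since it maps the
disc of radius `t` into itself, of absolute value `≤ 1`. [cite: Mochizuki2012, Ex 3.4 (i) p.80] -/
theorem scalar_mem_unitDisc {φ : std t ⟶ std t}
    (hφ : φ ∈ PreFrobenioid.endSubmonoid (C.toElem ptBase) (std t)) :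
    ((C0.scalar φ.fst : ℂˣ) : ℂ) ∈ unitDisc := by
  refine ⟨(C0.scalar φ.fst).ne_zero, ?_⟩
  have hiso : (std t).fst.region.IsIsotropic := std_isNaivelyIsotropic t
  -- the point `t ∈ A_{std t}` is mapped into `A_{std t}` by `φ`
  have hu : ofPosReal ℂ t ∈ (std t).fst.region.carrier := by
    rw [C0.mem_carrier_of_isIsotropic hiso, ← Subtype.coe_le_coe, coe_absHom, coe_ofPosReal,
      RCLike.norm_ofReal, abs_of_pos t.2]
    exact le_refl (t : ℝ)
  have hmaps : C0.scalar φ.fst • (std t).fst.region.carrier ^ (C0.degFr φ.fst : ℕ) ⊆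
      (std t).fst.pullRegion (C0.Base φ.fst) := (φ.fst).mapsTo
  rw [degFr_fst_eq_one hφ, PNat.one_coe, pow_one, base_fst_eq_id φ] at hmaps
  erw [C0.pullRegion_id] at hmaps
  have hcu := hmaps (Set.smul_mem_smul_set hu)
  rw [C0.mem_carrier_of_isIsotropic hiso, ← Subtype.coe_le_coe, coe_absHom] at hcu
  change ‖(((C0.scalar φ.fst) * ofPosReal ℂ t : ℂˣ) : ℂ)‖ ≤ (t : ℝ) at hcu
  rw [Units.val_mul, norm_mul, coe_ofPosReal, RCLike.norm_ofReal, abs_of_pos t.2] at hcu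
  exact le_of_mul_le_mul_right (by rwa [one_mul]) t.2

/-- The endomorphism `(id, 1, z)` of `std t` for `z ∈ O^▷_ℂ`. [cite: Mochizuki2012, Ex 3.4 (i) p.80] -/
def endOfUnitDisc (t : PosReal) (z : unitDisc) : std t ⟶ std t where
  fst := C0.homToIso (𝟙 D0.complex) t (Units.mk0 (z : ℂ) (mem_unitDisc.1 z.2).1)
    (by change _ ∈ D0.scalars D0.complex; rw [D0.scalars_complex]; exact Subgroup.mem_top _) (by
    rw [Units.val_mk0]
    change ‖(z : ℂ)‖ * (t : ℝ) ≤ t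
    exact mul_le_of_le_one_left t.2.le (mem_unitDisc.1 z.2).2)
  snd := 𝟙 _
  w := rfl

/-- `(id, 1, z)` is a base-identity linear endomorphism, i.e. an element of `O^▷(std t)`.
[cite: MochizukiFrdI2008, Def. 1.2(ii)] -/
theorem endOfUnitDisc_mem (t : PosReal) (z : unitDisc) :
    (endOfUnitDisc t z : End (std t)) ∈ PreFrobenioid.endSubmonoid (C.toElem ptBase) (std t) :=
  ⟨rfl, rfl⟩

/-- **`O^▷(C_v) ⥲ O^▷_ℂ`** at the isotropic object `std t`: the monoid of base-identity linear
endomorphisms of `std t` ([FrdI] Def. 1.2 (ii), found's `PreFrobenioid.endSubmonoid`) is the monoid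
of scalars `{z : 0 < |z| ≤ 1}` — "by construction, there is a natural isomorphism
`O^▷(C_v) ⥲ O^▷_{K_v}`" (monoid level). [cite: Mochizuki2012, Ex 3.4 (i) p.80] -/
def endEquivUnitDisc (t : PosReal) :
    PreFrobenioid.endSubmonoid (C.toElem ptBase) (std t) ≃* unitDisc where
  toFun φ := ⟨(C0.scalar (φ.1 : std t ⟶ std t).fst : ℂ), scalar_mem_unitDisc φ.2⟩
  invFun z := ⟨endOfUnitDisc t z, endOfUnitDisc_mem t z⟩
  left_inv φ := by
    apply Subtype.ext
    refine CFP.Hom.ext (C0.hom_ext ?_ ?_ ?_) (Subsingleton.elim _ _)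
    · exact (base_fst_eq_id (φ.1 : std t ⟶ std t)).symm
    · exact (degFr_fst_eq_one φ.2).symm
    · exact Units.mk0_val _ (C0.scalar _).ne_zero
  right_inv z := Subtype.ext (Units.val_mk0 (mem_unitDisc.1 z.2).1)
  map_mul' φ ψ := by
    apply Subtype.ext
    change ((C0.scalar ((ψ.1 : std t ⟶ std t) ≫ (φ.1 : std t ⟶ std t)).fst : ℂˣ) : ℂ) =
      (C0.scalar (φ.1 : std t ⟶ std t).fst : ℂ) * (C0.scalar (ψ.1 : std t ⟶ std t).fst : ℂ)
    have hcomp : ((ψ.1 : std t ⟶ std t) ≫ (φ.1 : std t ⟶ std t)).fst =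
        (ψ.1 : std t ⟶ std t).fst ≫ (φ.1 : std t ⟶ std t).fst := rfl
    rw [hcomp, C0.scalar_comp', base_fst_eq_id (ψ.1 : std t ⟶ std t), degFr_fst_eq_one φ.2,
      PNat.one_coe, pow_one, Units.val_mul]
    dsimp only [D0.Hom.act]
    erw [D0.twists_id, D0.galAct_false]

/-- The scalar read off by the isomorphism. [cite: Mochizuki2012, Ex 3.4 (i) p.80] -/
theorem coe_endEquivUnitDisc (φ : PreFrobenioid.endSubmonoid (C.toElem ptBase) (std t)) :
    ((endEquivUnitDisc t φ : unitDisc) : ℂ) = (C0.scalar (φ.1 : std t ⟶ std t).fst : ℂ) := rfl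

/-! ### `O^▷(C_v)` as a commutative topological monoid (topology induced from `ℂ`) -/

/-- `O^▷(std t)` is commutative (it is isomorphic to a submonoid of `ℂ`) — a `CommMonoid` structure as a
definition (no instance). [cite: Mochizuki2012, Ex 3.4 (i) p.80] -/
abbrev endCommMonoid (t : PosReal) : CommMonoid (PreFrobenioid.endSubmonoid (C.toElem ptBase) (std t)) :=
  { (inferInstance : Monoid (PreFrobenioid.endSubmonoid (C.toElem ptBase) (std t))) with
    mul_comm := fun a b => (endEquivUnitDisc t).injective (by rw [map_mul, map_mul, mul_comm]) }

/-- The topology on `O^▷(std t)` INDUCED from `ℂ` along the scalar map (a definition; the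
category-theoretic reconstruction of this topology is [FrdII] Thm. 3.6 (i), (vii), not used here).
[cite: Mochizuki2012, Ex 3.4 (i) p.80] -/
abbrev endTopology (t : PosReal) : TopologicalSpace (PreFrobenioid.endSubmonoid (C.toElem ptBase) (std t)) :=
  TopologicalSpace.induced (fun φ => ((endEquivUnitDisc t φ : unitDisc) : ℂ)) inferInstance

/-- With the induced topology the scalar map to `ℂ` is an inducing map. [cite: Mochizuki2012, Ex 3.4 (i) p.80] -/
theorem isInducing_scalar (t : PosReal) :
    @IsInducing _ _ (endTopology t) _ (fun φ => ((endEquivUnitDisc t φ : unitDisc) : ℂ)) :=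
  letI := endTopology t
  ⟨rfl⟩

/-- With the induced topology `O^▷(std t) ⥲ O^▷_ℂ` is continuous. [cite: Mochizuki2012, Ex 3.4 (i) p.80] -/
theorem continuous_endEquivUnitDisc (t : PosReal) :
    @Continuous _ _ (endTopology t) _ (endEquivUnitDisc t) := by
  letI := endTopology t
  exact continuous_induced_rng.2 continuous_induced_dom

/-- … and so is its inverse. [cite: Mochizuki2012, Ex 3.4 (i) p.80] -/
theorem continuous_endEquivUnitDisc_symm (t : PosReal) :
    @Continuous _ _ _ (endTopology t) (endEquivUnitDisc t).symm := by
  letI := endTopology t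
  refine continuous_induced_rng.2 ?_
  have : (fun φ => ((endEquivUnitDisc t φ : unitDisc) : ℂ)) ∘ (endEquivUnitDisc t).symm =
      fun z : unitDisc => (z : ℂ) := by
    funext z
    simp only [Function.comp_apply, MulEquiv.apply_symm_apply]
  rw [this]
  exact continuous_subtype_val

/-- With the induced topology multiplication on `O^▷(std t)` is continuous (a `ContinuousMul`
structure as a theorem-valued definition, no instance). [cite: Mochizuki2012, Ex 3.4 (i) p.80] -/
theorem endContinuousMul (t : PosReal) :
    @ContinuousMul _ (endTopology t) _ := by
  letI := endTopology t
  have hind : IsInducing (fun φ : PreFrobenioid.endSubmonoid (C.toElem ptBase) (std t) =>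
      ((endEquivUnitDisc t φ : unitDisc) : ℂ)) := isInducing_scalar t
  exact hind.continuousMul ((unitDisc.subtype).comp (endEquivUnitDisc t).toMonoidHom)

end Cpt

end ArchFrd

end

end Literature.AlgebraicGeometry.Frobenioids
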